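import Literature.AlgebraicGeometry.Resolution.KollarMaxContactStep
import Literature.AlgebraicGeometry.Resolution.KollarMaxContactIndepBD
import Literature.AlgebraicGeometry.Resolution.KollarStep2Stage
import Literature.AlgebraicGeometry.Resolution.KollarStepThreeData
import Literature.AlgebraicGeometry.Resolution.SpreadsShapedFromGenericPointProof
import HarnessLib

/-!
# BGMW 2011, Cor. 8.0.6 (embedded form) — the discharge of `BierstoneGrigorievMilmanWlodarczyk2011_embedded`

Topic: `Literature/AlgebraicGeometry/Resolution`. DISCHARGE of the named fact
`BierstoneGrigorievMilmanWlodarczyk2011_embedded` (`EmbeddedResolution.lean`: Bierstone–Grigoriev–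
Milman–Włodarczyk, *Effective Hironaka resolution and its complexity (with appendix on
applications in positive characteristic)*, arXiv:1206.3090, Cor. 8.0.6 in the embedded form of
Thm. 2.0.2 (1)–(3): for `k` perfect of characteristic `p > M(d, n, l)` and `Y ⊆ 𝔸ⁿ_k` cut out by
at most `l` polynomials of degree `≤ d`, a finite sequence of blow-ups of `𝔸ⁿ_k` along regular
centres lying over the singular locus of `Y` whose strict transform of `Y` is regular).

The proof is the paper's, assembled from the tree: Cor. 8.0.6 ⇐ Thm. 8.0.5 (canonical resolution
of the marked ideal `(𝔸ⁿ_k, 𝓘_Y, ∅, 1)` with its functoriality (2) for the open immersions into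
the regular locus) by the Hironaka resolution principle §3.3 (2) ⇒ (3) and Thm. 2.0.2
(`bierstoneGrigorievMilmanWlodarczyk2011_embedded_of_canonical''`, `CanonicalResolutionProofs.lean`;
fields are J-2, `FieldsJ2.lean`); Thm. 8.0.5 for these marked ideals in characteristic
`p > M(d, n, l)` ⇐ its characteristic-zero counterpart (Thm. 4.0.6) by spreading out over
`Spec ℤ[c]` and Noetherian induction (`canonical_of_charZero_of_spreads`,
`CanonicalResolutionSpread.lean`, with the spreading step `spreadsShapedFromGenericPoint_holds`,
`SpreadsShapedFromGenericPointProof.lean`); Thm. 4.0.6 ⇐ Kollár's Thm. 3.69 in every dimension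
(`canonicalCharZero_of_kollarThms`, `CanonicalResolutionKollar.lean`: the value of a functorial
order reduction on `(U, 𝓘_Z, ∅)` for a regular `Z` is the single blow-up of `Z`) ⇐ Kollár's two
inductive steps Thm. 3.103 and Thm. 3.107, both theorems of the tree
(`Kollar2007Thm3_103_holds`, `Kollar2007Thm3_107_holds`, `KollarBlowupSequenceFunctorsProofs.lean`).
The composite is `embedded_of_kollarThms_of_spreads` (`CanonicalResolutionKollar.lean`).

* **`BierstoneGrigorievMilmanWlodarczyk2011_embedded_holds`** — the discharge.

Implementation note (2026-08-15): the two Kollár leaves are fed in through PRIVATE copies of the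
short assembly proofs of `KollarBlowupSequenceFunctorsProofs.lean` (its Parts 1–4: Thm. 3.103 from
3.104 with Step 2.3 via Thms. 3.92 + 3.97; Thm. 3.107 from the three stages of 3.111), built on the
same imported machinery (`KollarMaxContactStep.lean`, `KollarMaxContactIndepBD.lean`,
`KollarStep2Stage.lean`, `KollarStepThreeData.lean`), rather than by importing that module, whose
compiled interface was unavailable on the build farm when this file was landed (farm
"incoherent … mismatch" for that one module). The private block is logically identical to the
tree's `Kollar2007Thm3_103_holds` / `Kollar2007Thm3_107_holds` and can be replaced by the import
at any later clean-up; no statement is duplicated under a public name.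

## Sources

* E. Bierstone, D. Grigoriev, P. Milman, J. Włodarczyk, *Effective Hironaka resolution and its
  complexity (with appendix on applications in positive characteristic)*, Asian J. Math. 15
  (2011) 193–228 / arXiv:1206.3090: Cor. 8.0.6, Thm. 8.0.5, Lemma 8.0.3, Thm. 4.0.6, §3.3,
  Thm. 2.0.2 (arXiv numbering). [BierstoneGrigorievMilmanWlodarczyk2011]
* J. Kollár, *Lectures on Resolution of Singularities*, Ann. of Math. Stud. 166 (2007): 3.70 with
  Thm. 3.103 (p. 171; proof 3.104–3.105, 3.102, 3.92, 3.97, 3.99) and Thm. 3.107 (p. 175; proof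
  3.109–3.111) of the held copy. [Kollar2007]
-/

noncomputable section

open CategoryTheory CategoryTheory.Limits AlgebraicGeometry TopologicalSpace

namespace Literature.AlgebraicGeometry.Resolution

universe u v

/-! ## Private copies of the assembly of Kollár's two inductive steps (see the implementation note) -/

section KollarThm3103Assembly


namespace Kollar2007

/-- **In dimension `0` the empty sequence (whatever the hypersurface) is a hypersurface order
reduction** (`cosupp(I, m) = ∅` for `m ≥ 1`; the hypersurfaces upstairs are `h^{-1}(H)`, `H_{L,σ}`,
`H`). [cite: Kollar2007, 3.70 (p. 150)] -/
private theorem isHypersurfaceOrderReduction_zero_aux {m : ℕ} (hm : 1 ≤ m) :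
    IsHypersurfaceOrderReduction 0 m (fun _ _ _ T _ => CentreSeq.nil.{u} T.X) where
  isResolutionOf _ _ _ T _ _ :=
    ⟨(CentreSeq.isResolutionOf_nil_iff _).mpr (T.support_marked_eq_empty hm), trivial⟩
  indep _ _ _ _ _ _ _ := rfl
  smooth _ _ _ _ _ _ _ _ _ hpb H := ⟨H.comapAlong hpb, fun _ => rfl, rfl⟩
  fieldChange _ _ _ _ _ _ σ _ _ _ _ _ hfc H := ⟨H.ofFieldChange σ hfc, rfl⟩
  ignoresEmpty _ _ _ _ E hE hE' _ _ H := ⟨H.withBoundary E hE hE', rfl⟩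

end Kollar2007

open Kollar2007

/-- **Kollár's Theorem 3.103, assembled — conditional only on the independence of the chosen
hypersurface (Step 2.3: Thms. 3.92 + 3.97).** For a tuning parameter `s₀ ≥ 1`: if for every
`n`, `m ≥ 1` and functors `BMO₁`, `BMO₂` on dimension-`n` triples satisfying the clauses of
Thm. 3.69 for the markings `m!` and `(m·s₀)!`, Kollár's Step 2 sequence
`step2 BMO₁ BMO₂ hm s₀ hs₀ _ T H` (Step 2.1: `𝓑𝓓` over the boundary; Step 2.2: `𝓑𝓓` on
`(X_r, W_{m s₀}(I_r), H_r + E'_r)` for the member `H_r`) is the same for any two hypersurfaces of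
maximal contact `H, H'` of a triple `T` of dimension `n + 1` with `max-ord I ≤ m`, then
`Kollar2007Thm3_103` holds: in dimension `0` by the empty sequence; in dimension `n + 1` the
functors `𝓑𝓜𝓞_{n,m!}`, `𝓑𝓜𝓞_{n,(m s₀)!}` of the hypothesis (3.69) in dimension `n` feed
`Kollar2007.hypersurfaceFunctor`, whose clauses are `isHypersurfaceOrderReduction_of_indep`, and
`Kollar2007Thm3_103_of_hypersurfaceFunctor` (choice of `H`, globalization 3.105) concludes.
[cite: Kollar2007, Thm. 3.103 and its proof (pp. 171–173); 3.104; 3.70] -/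
private theorem thm3_103_of_step2_indep_aux (s₀ : ℕ) (hs₀ : 1 ≤ s₀)
    (hindep : ∀ (n m : ℕ) (hm : 1 ≤ m) (BMO₁ BMO₂ : BlowupSequenceFunctor.{u} n)
      (h₁ : ∀ ⦃k : Type u⦄ [Field k] [CharZero k] (R : Triple k n),
        (BMO₁ R).IsResolutionOf (R.marked (Nat.factorial m)) ∧ (BMO₁ R).NoEmptyCentres)
      (_ : CommutesWithSmoothMorphisms (TripleClass.all n) BMO₁)
      (_ : CommutesWithFieldChange (TripleClass.all n) BMO₁)
      (_ : IgnoresEmptyDivisors (TripleClass.all n) BMO₁)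
      (_ : ∀ ⦃k : Type u⦄ [Field k] [CharZero k] (R : Triple k n),
        (BMO₂ R).IsResolutionOf (R.marked (Nat.factorial (m * s₀))) ∧ (BMO₂ R).NoEmptyCentres)
      (_ : CommutesWithSmoothMorphisms (TripleClass.all n) BMO₂)
      (_ : CommutesWithFieldChange (TripleClass.all n) BMO₂)
      (_ : IgnoresEmptyDivisors (TripleClass.all n) BMO₂),
      ∀ ⦃k : Type u⦄ [Field k] [CharZero k] (T : Triple k (n + 1)) (H H' : MaxContactHypersurface m T),
        T.MaxOrdLE m →
          step2 BMO₁ BMO₂ hm s₀ hs₀ (fun _ _ _ R => (h₁ R).1.1) T H =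
            step2 BMO₁ BMO₂ hm s₀ hs₀ (fun _ _ _ R => (h₁ R).1.1) T H') :
    Kollar2007Thm3_103.{u} :=
  Kollar2007Thm3_103_of_hypersurfaceFunctor fun n ih m hm => by
    cases n with
    | zero => exact ⟨fun _ _ _ T _ => CentreSeq.nil T.X, isHypersurfaceOrderReduction_zero_aux hm⟩
    | succ n =>
      obtain ⟨BMO₁, h₁, hsm₁, hfcC₁, hie₁⟩ := ih n (Nat.lt_succ_self n) (Nat.factorial m) (Nat.factorial_pos m)
      obtain ⟨BMO₂, h₂, hsm₂, hfcC₂, hie₂⟩ :=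
        ih n (Nat.lt_succ_self n) (Nat.factorial (m * s₀)) (Nat.factorial_pos (m * s₀))
      exact ⟨hypersurfaceFunctor BMO₁ BMO₂ hm s₀ hs₀ (fun _ _ _ R => (h₁ R).1.1),
        isHypersurfaceOrderReduction_of_indep BMO₁ BMO₂ hm s₀ hs₀ _ (fun _ _ _ R => (h₁ R).1) hsm₁ hfcC₁ hie₁
          (fun _ _ _ R => (h₂ R).1) hsm₂ hfcC₂ hie₂
          (hindep n m hm BMO₁ BMO₂ h₁ hsm₁ hfcC₁ hie₁ h₂ hsm₂ hfcC₂ hie₂)⟩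

end KollarThm3103Assembly

section KollarStep2Indep


namespace Kollar2007

variable {n : ℕ} (BMO₁ BMO₂ : BlowupSequenceFunctor.{u} n) {m : ℕ} (hm : 1 ≤ m) (s₀ : ℕ) (hs₀ : 1 ≤ s₀)
  (hBMO₁ : ∀ ⦃k : Type u⦄ [Field k] [CharZero k] (R : Triple k n),
    (BMO₁ R).IsAdmissibleFor (R.marked (Nat.factorial m)))

/-! ## (indep) for Step 2 from étale equivalence -/

section Indep

variable {k : Type u} [Field k] [CharZero k]
  (hBMO₂ : ∀ ⦃k : Type u⦄ [Field k] [CharZero k] (R : Triple k n),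
    (BMO₂ R).IsAdmissibleFor (R.marked (Nat.factorial (m * s₀))))
  (hsm₂ : CommutesWithSmoothMorphisms (TripleClass.all n) BMO₂)
  (hie₂ : IgnoresEmptyDivisors (TripleClass.all n) BMO₂)

include hBMO₂ hsm₂ hie₂ in
/-- **Step 2.3 for the constructed Step 2: on top of the same `q`, the last chunks for `H` and `H'`
coincide** ("We can use either of the two blow-up sequences `𝓑𝓓_{n,m,0}(X,I,H+E)` and
`𝓑𝓓_{n,m,0}(X,I,H'+E)` … By (3.92) … étale equivalent … By (3.97) … these blow-up sequences are
identical"): the chunk IS `𝓑𝓓` of the triple `Triple.stepTwoBase … |>.withBoundary (H_q + E'_q)`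
for its first member, so this is the tree's `MaxContactHypersurface.bd_stepTwo_eq`
(`KollarMaxContactIndepBD.lean`: Thm. 3.92 for the MC-invariant re-tuned ideal `W_s(I_q)`,
`etaleEquivalent_stepTwoBase`, then "étale equivalent ⟹ identical", `apply_stepTwoTriple_eq` /
`apply_eq_of_etaleEquivalent`, for a functor extending "`𝓑𝓓` of the first member").
[cite: Kollar2007, 3.104 Step 2.3 (p. 173); Thms. 3.92, 3.97] -/
private theorem step2Chunk_eq_aux (T : Triple k (n + 1)) (H H' : MaxContactHypersurface m T)
    (q : CentreSeq T.X) (hq : q.IsAdmissibleFor (T.marked m)) :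
    step2Chunk BMO₂ hm s₀ hs₀ T H q hq = step2Chunk BMO₂ hm s₀ hs₀ T H' q hq :=
  MaxContactHypersurface.bd_stepTwo_eq H H' hm q hq (one_le_mul_marking hm s₀ hs₀) BMO₂ hsm₂ hie₂ hBMO₂
    (transformDivisor_mem_topW_boundary hm s₀ hs₀ T H q hq)
    (transformDivisor_mem_topW_boundary hm s₀ hs₀ T H' q hq)

include hBMO₂ hsm₂ hie₂ in
/-- **(indep) for Step 2**: `step2 … T H = step2 … T H'` — Step 2.1 (`bdFold`) does not see the
hypersurface, and the last chunks agree (`step2Chunk_eq`). [cite: Kollar2007, 3.104 Step 2.3 (p. 173)] -/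
private theorem step2_indep_aux (T : Triple k (n + 1)) (H H' : MaxContactHypersurface m T) :
    step2 BMO₁ BMO₂ hm s₀ hs₀ hBMO₁ T H = step2 BMO₁ BMO₂ hm s₀ hs₀ hBMO₁ T H' := by
  unfold step2 step2Of
  rw [step2Chunk_eq_aux BMO₂ hm s₀ hs₀ hBMO₂ hsm₂ hie₂ T H H']

end Indep

end Kollar2007

end KollarStep2Indep

section KollarBlowupSequenceFunctorsProofs

open Kollar2007

/-- **Kollár's Theorem 3.103, PROVED** — the discharge of the named fact `Kollar2007Thm3_103`:
assuming Thm. 3.69 (order reduction for marked ideals) in dimensions `< n`, Thm. 3.68 (order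
reduction for ideals: the functors `𝓑𝓞_{n,m}` with the functoriality package 3.34) holds in
dimension `n`. Kollár's proof, assembled: `Kollar2007Thm3_103_of_step2_indep` (Steps 1, 2.1, 2.2,
3 and the induction 3.70) with tuning parameter `s₀ = 1` (the marking `W_m(I_r)`; any `s₀ ≥ 1`
works) and, for its only hypothesis (indep), `step2_indep` (Step 2.3: Thms. 3.92 + 3.97 for the
MC-invariant re-tuned ideal, Prop. 3.99 (5)).
[cite: Kollar2007, Thm. 3.103 (p. 171); proof: 3.104 (pp. 172–173), 3.102, 3.92, 3.97, 3.99, 3.105, 3.70] -/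
private theorem thm3_103_aux : Kollar2007Thm3_103.{u} :=
  thm3_103_of_step2_indep_aux 1 le_rfl
    fun _ _ hm BMO₁ BMO₂ h₁ _ _ _ h₂ hsm₂ _ hie₂ _ _ _ T H H' _ =>
      step2_indep_aux BMO₁ BMO₂ hm 1 le_rfl (fun _ _ _ R => (h₁ R).1.1) (fun _ _ _ R => (h₂ R).1.1)
        hsm₂ hie₂ T H H'

end KollarBlowupSequenceFunctorsProofs

section KollarThm3107

namespace Kollar2007

variable {n m : ℕ}

/-- **A stage restricts to a smaller source class and a larger target class** (every clause is
quantified over the source class). [folklore] -/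
private theorem restrictStage_aux (hm : 1 ≤ m) {𝒞 𝒞' 𝒟 𝒟' : TripleClass.{u} n}
    {B : BlowupSequenceFunctor.{u} n} (H : IsStageFunctor hm 𝒞 𝒟 B)
    (h𝒞 : ∀ ⦃k : Type u⦄ [Field k] [CharZero k] (T : Triple k n), 𝒞' T → 𝒞 T)
    (h𝒟 : ∀ ⦃k : Type u⦄ [Field k] [CharZero k] (T : Triple k n), 𝒟 T → 𝒟' T) :
    IsStageFunctor hm 𝒞' 𝒟' B where
  adm _ _ _ T hT := H.adm T (h𝒞 T hT)
  noEmpty _ _ _ T hT := H.noEmpty T (h𝒞 T hT)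
  post _ _ _ T hT := h𝒟 _ (H.post T (h𝒞 T hT))
  comm := fun _ _ _ T T' h _ hT hT' hpb => H.comm T T' h (h𝒞 T hT) (h𝒞 T' hT') hpb
  commF := fun _ _ _ _ _ _ σ T T' g hT hT' hF => H.commF σ T T' g (h𝒞 T hT) (h𝒞 T' hT') hF
  ign := fun _ _ _ T E hE hE' hrem hT hTE => H.ign T E hE hE' hrem (h𝒞 T hT) (h𝒞 _ hTE)

/-- **The Step-2 stage of 3.111 in the shape consumed by `kollar2007Thm3_107_of_stepTwoStage`**:
from `max-ord N(I) ≤ m - 1` (indeed from all triples, `step2_isStageFunctor`) to the class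
`cosupp(I, m) ∩ cosupp N(I) = ∅` of Step 3 (`stepThreeClass`, via `step2Class_pred_iff`).
[cite: Kollar2007, 3.111 Step 2 (p. 177)] -/
private theorem exists_isStageFunctor_stepTwo_aux (h68 : OrderReductionInDim.{u} n) (m : ℕ) (hm : 1 ≤ m) :
    ∃ B₂ : BlowupSequenceFunctor.{u} n,
      IsStageFunctor hm (step1Class m (m - 1)) (stepThreeClass n m) B₂ :=
  ⟨step2Functor hm h68, restrictStage_aux hm (step2_isStageFunctor hm h68) (fun _ _ _ _ _ => trivial)
    fun _ _ _ T hT x hxN hxI => ((step2Class_pred_iff T).mp hT) x hxI hxN⟩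

/-- **Kollár's Theorem 3.107** ((3.68) in dimensions `≤ n` ⟹ (3.69) in dimension `n`): Steps 1,
2, 3 of 3.111 composed. [cite: Kollar2007, Thm. 3.107 (p. 175); proof 3.109–3.111 (pp. 176–178)] -/
private theorem thm3_107_aux' : Kollar2007Thm3_107.{u} :=
  kollar2007Thm3_107_of_stepTwoStage fun _ h68 m hm => exists_isStageFunctor_stepTwo_aux h68 m hm

end Kollar2007

/-- **Kollár 2007, Theorem 3.107, PROVED — the discharge of the named fact `Kollar2007Thm3_107`**
(`KollarBlowupSequenceFunctors.lean`): assuming Thm. 3.68 (order reduction for ideals) in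
dimensions `≤ n`, Thm. 3.69 (order reduction for marked ideals, with the functoriality package
3.34 and the convention 3.32) holds in dimension `n`. Kollár's proof 3.109–3.111 assembled from
the three stages of 3.111 (Step 1: `KollarStep1Stage.lean`; Step 2: `KollarStep2Stage.lean`;
Step 3: `KollarStepThreeData.lean`, with the componentwise monomial part of the erratum in
`KollarBlowupSequenceFunctors.lean`). [cite: Kollar2007, Thm. 3.107 (p. 175); proof 3.109–3.111 (pp. 176–178)] -/
private theorem thm3_107_aux : Kollar2007Thm3_107.{u} :=
  Kollar2007.thm3_107_aux'

end KollarThm3107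

/-! ## The discharge -/

/-- **BGMW 2011, Cor. 8.0.6 (embedded form) — PROVED**: Kollár's Theorems 3.103 and 3.107 and the
spreading-out step (`spreadsShapedFromGenericPoint_holds`) fed into
`embedded_of_kollarThms_of_spreads` (Thm. 8.0.5 for `(𝔸ⁿ_k, 𝓘_Y, ∅, 1)` in characteristic
`p > M(d, n, l)`, then §3.3 (2) ⇒ (3) and Thm. 2.0.2).
[cite: BierstoneGrigorievMilmanWlodarczyk2011, Cor. 8.0.6 with Thm. 8.0.5 and Thm. 2.0.2]
[cite: Kollar2007, Thms. 3.103 (p. 171), 3.107 (p. 175)] -/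
theorem BierstoneGrigorievMilmanWlodarczyk2011_embedded_holds :
    BierstoneGrigorievMilmanWlodarczyk2011_embedded :=
  embedded_of_kollarThms_of_spreads thm3_103_aux thm3_107_aux spreadsShapedFromGenericPoint_holds

end Literature.AlgebraicGeometry.Resolution

end
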